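import Summits.QuantumFields.BalabanUV.Beta.SymmetrisedDressingHessian
import Summits.QuantumFields.BalabanUV.Beta.KernelWardSymEnd
import Summits.QuantumFields.BalabanUV.Beta.RelInvSymBorderedHessianStep

/-!
# `BalabanUV.Beta.RowD1JointEndSym` — binder row D1, SYMMETRISED literal «JsB12Sym»: **THE ROW's END AT JetData LEVEL** —
# `D1Drift` for the centred symmetrised-dressed family `j ↦ dressSymAt ctr (Js⁰ j)` from EXACTLY {hW, the compensated hR∧hSX sockets, D1Tel, D1Rep,
# printed B5 facts, window} (β sub-cell, BINDER-OWNERS row D1 OWNER b2b-balaban-beta-an2, gen 26; v1 = the (0.4) ROOT PLACEHOLDER of the row made a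
# theorem, generic in the UNDRESSED jets `Js⁰` — the literal `JsB12Sym⁰` (sym tables P¹∕P²∕P³ + the slice-exchange row) instantiates it when typed)

HONEST FRAMING (cell charter, verbatim): «discharging BetaPertH makes Balaban's UV stability UNCONDITIONAL — a real
constructive-QFT result; it is NOT the continuum limit and NOT the Clay problem.»
HONEST DEPENDENCY: continuum YM on T⁴ ⇐ BetaPertH ∧ nine spine estimates (0/9 proved); BetaPertH ⇐ (D1) ∧ (D4) ∧ CAP+tail;
G-an2-4 gates asym, D1 and NE2/3/4.
DERIVED cell leaf ([folklore] wiring BY NAME).  No statement of Bałaban's papers, no `[cite:]`, no `Prop` fact and no `def` is minted; EVERY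
hypothesis below is a displayed BINDER: the Ward transversality `hW` of the family (the sym hW END is not yet typed), the spread kernels `𝕄 j`,
the contact families `C j α` ∕ `X₂ j α`, the COMPENSATORS `Wc j α` with the cancellation `hcomp` (the typed interface of the slice-exchange
binder hSX, RULINGS R-D1-g25-4 ∕ R-D1-g26-1), the jet laws (St)(Wt)(Sr-conj)(Wr-conj-c) of the undressed jets, `D1Tel`, `D1Rep`, the printed
B5 facts `h12`∕`h126` and the window data of `OneStepKernelFamily.d1Drift_of_D1Tel_D1Rep`.  Discharges NO binder of the wall: 0∕4
(hW, hR, hP, hSX) for the literal of record.  NOT D1, NOT `BetaPertH`, NOT continuum, NOT Clay.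

WHAT (`d + 1 = 4`, `Lc` odd, `2 ≤ Lc`).
* §1 **`axisReflectionCovariant_dressSymCtr`** = `SymmetrisedDressingHessian.axisReflectionCovariant_flipK_TbalOf_dressSymCtr_compensated`
  re-exported in the row's vocabulary (hR∧hSX ⟸ the compensated sockets; `hGr` discharged by `refK_coDressKSymAt_KInvStep`).
* §2 **`d1Drift_dressSymCtr_of_hW_compensated_D1Tel_D1Rep`**: `D1Drift Lc (j ↦ dressSymAt ctr (Js⁰ j)) Nc μ ν` ⟸ EXACTLY {`hW`, the
  compensated hR∧hSX sockets, `D1Tel`, `D1Rep`, B5 `h12`∕`h126`, window `(cc, M)`, `μ ≠ ν`, `Nc ≠ 0`, `2 ≤ Lc`, `Odd Lc`} —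
  `OneStepKernelFamily.d1Drift_of_D1Tel_D1Rep` at `Js := j ↦ dressSymAt ctr (Js⁰ j)` with `hR` supplied by §1.
So, for the symmetrised dressing, the β-row D1 reads in the kernel: **D1Drift ⟸ hW ∧ [conjugated jet laws + compensators with `hcomp`] ∧ D1Tel ∧ D1Rep**
(+ printed facts and bookkeeping data).  HONEST: none of these binders is proved here or anywhere in the tree for Bałaban's tables; the undressed
literal `JsB12Sym⁰` (an1's TABLES-SYM steps 2–3, an3's letters, the slice-exchange row) is NOT yet typed; 0∕4 binders.
Provenance: β sub-cell, unit beta-an2 gen 26, 2026-08-21 (v1); no existing file touched.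
## v1.1 (2026-08-21; D1 formalisation swarm leaf seat `b2b-balaban-beta-d1-formalise-leaf-04` gen 8, on the row-D1 OWNER an2-g26's RULING R-D1-g26-2 (D)
«GO (narrow) … + a ≤ 60-line root re-instantiation `RowD1JointEndSym` v1.1 APPEND-ONLY by me or you taking hW from it») — APPEND-ONLY §3
Every v1 declaration is byte-identical; ONE import is added (`Beta.KernelWardSymEnd`, p250131 — the sym hW SOCKET) and §3
**`d1Drift_dressSymCtr_of_wardLetters_compensated_D1Tel_D1Rep`** is ADDED: the §2 END with the DIRECT binder `hW` REPLACED by its derivation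
`KernelWardSymEnd.wardTransversal_flipK_TbalOf_dressSymCtr_rel` from DISPLAYED Ward-letter sockets over a relative inverse (coarse projector `E` with
`RelInv G_j (𝕄 j) E`, the column-difference law `hH` with constants `cH j`, the S-letter `hSd` through `conjV (𝕄 j) (X j y)`, the W-letter `hWd`
through `conjW (𝕄 j) …` with a tadpole-null remainder `Nr`).  So the row's (0.4) root now reads
**D1Drift ⟸ [Ward letters + RelInv sockets] ∧ [conjugated jet laws + compensators with `hcomp`] ∧ D1Tel ∧ D1Rep** (+ printed facts, window).
HONEST: a re-instantiation; every socket is a displayed hypothesis; NO binder of the wall is discharged (root-level binders hW-sockets ∕ hR-sockets ∕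
hSX-socket ∕ D1Tel ∕ D1Rep — 0 discharged); the undressed literal `JsB12Sym⁰` is NOT yet typed; NOT D1, NOT `BetaPertH`, NOT continuum, NOT Clay.

## v1.2 (2026-08-21; same leaf seat, same GO) — APPEND-ONLY §4: the row-D1 OWNER an2-g26's OWN staged v1.1 variant
(`HOME/b2b-balaban-beta-an2/gen26/RowD1JointEndSym.v1.1.48c8546513e9123a.staged.lean`, cert rc 0, which the v1.1 above pre-empted) is ADDED VERBATIM as
**`d1Drift_dressSymCtr_of_wardSockets_compensated_D1Tel_D1Rep`**: the PARITY form of the sym hW END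
(`KernelWardSymEnd.wardTransversal_flipK_TbalOf_dressSymCtr_rel_parity`: structural remainder `trK Nr = −sgnK Nr` instead of `tadpole Nr = 0`) with a
SEPARATE Ward-side spread `𝕄ʷ j` (more general than §3's shared `𝕄 j`).  Every v1∕v1.1 declaration byte-identical.  HONEST: a re-instantiation;
0 binders discharged; NOT D1, NOT `BetaPertH`, NOT continuum, NOT Clay.
## v1.3 (2026-08-21; BINDER-OWNERS row D1 OWNER b2b-balaban-beta-an2 gen 27) — APPEND-ONLY §5: THE SPREADS OF RECORD INSTANTIATED.
§4 with the Ward-side spread, the hR-side spread and the coarse projector FIXED to the row's objects of record — `𝕄ʷ j = 𝕄 j := bhKStep 3 Lc j`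
(the straight bordered step Hessian, RULING R-D1-g25-5 (D-K4-2)) and `E := symEc Lc` (the symmetrised slice's kernel projector, chart (II)) — and
the three literal-INDEPENDENT sockets DISCHARGED BY NAME from the tree: `Spr (bhKStep 3 Lc j)` (`BorderedHessianStepStraight.spr_bhKStep`),
`Spr (symEc Lc)` (`SymSliceProjectorSpread.spr_symEc`) and **`∀ j, RelInv G_j (bhKStep 3 Lc j) (symEc Lc)`**
(`RelInvSymBorderedHessianStep.relInv_coDressKSymAt_KInvStep_bhKStep`, all four relative-inverse rules at every step).  ONE import added
(`Beta.RelInvSymBorderedHessianStep`); every v1∕v1.1∕v1.2 declaration byte-identical.  After §5 the displayed hypotheses of the row's END are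
EXACTLY: the jet LETTERS of the undressed literal — (St)(Wt), the ℋ-column Ward law `hH` of `G_j` (constants `cH j`; literal-independent, NOT
discharged here), the Ward divergence laws (Sd)(Wd) with their localised data `Xʷ, X₂ʷ, Nr` (commuting with `symEc Lc`, `Nr` parity-odd), the
conjugated reflection laws (Sr-conj)(Wr-conj-c) with their data `C, X₂, Wc`, the cancellation `hcomp` — plus `D1Tel`, `D1Rep`, the printed B5
facts and the window.  HONEST: socket bookkeeping over landed theorems; the root-level classes {hW-letters, hR-letters, hcomp, D1Tel, D1Rep} are
0∕5 discharged; `JsB12Sym⁰` is NOT yet a `def`; NOT D1, NOT `BetaPertH`, NOT continuum, NOT Clay.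
-/

open Finset
open scoped BigOperators
open Literature.MathematicalPhysics.QuantumFieldTheory
open Literature.MathematicalPhysics.QuantumFieldTheory.Balaban1983to89
open Literature.MathematicalPhysics.QuantumFieldTheory.Balaban1983to89.Beta
open Literature.MathematicalPhysics.QuantumFieldTheory.Balaban1983to89.Beta.VectorTailsLoc (fam kfam)
open Literature.MathematicalPhysics.QuantumFieldTheory.Balaban1983to89.Beta.VectorLegVolumeAdapter (MvE)
open ExpKernelCalculus (MKer Decays BiLoc comp tr tadpole shiftK)
open AffineAveraging (box toSite)
open AveragingContoursRooted (ctrOff ctrOff_mem_box)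
open PolarizationSign (reflSign WardTransversal AxisReflectionCovariant)
open KernelReflection (refK)
open ResolventReflection (bref Φ)
open OneStepResolventKernel (Fib LocStencil JetData)
open OneStepKernelFamily (KInvStep vertexOfK TbalOf flipK D1Tel D1Rep D1Drift d1Drift_of_D1Tel_D1Rep)
open Summit.QuantumFields.BalabanUV.Beta.TameKernelCalculus
open Summit.QuantumFields.BalabanUV.Beta.ChartConjugation (conjV conjW)
open Summit.QuantumFields.BalabanUV.Beta.ChartConjugationDefectEnd (conjDefect)
open Summit.QuantumFields.BalabanUV.Beta.AxialDressingRooted (one_le_of_neZero)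
open Summit.QuantumFields.BalabanUV.Beta.SymmetrisedDressingKernel (coDressKSymAt)
open Summit.QuantumFields.BalabanUV.Beta.SymmetrisedDressingDress (dressSymAt)
open Summit.QuantumFields.BalabanUV.Beta.SymmetrisedDressingHessian (axisReflectionCovariant_flipK_TbalOf_dressSymCtr_compensated)

namespace Summit.QuantumFields.BalabanUV.Beta.RowD1JointEndSym

noncomputable section

variable {Lc : ℕ} [NeZero Lc]

/-! ## §1 hR ∧ hSX for the centred symmetrised-dressed family, from the compensated sockets -/

/-- **hR FOR THE CENTRED SYMMETRISED-DRESSED FAMILY FROM THE COMPENSATED SOCKETS** (= `SymmetrisedDressingHessian.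
axisReflectionCovariant_flipK_TbalOf_dressSymCtr_compensated`, re-exported in the row's vocabulary): `Odd Lc`; BINDERS — spread `𝕄 j` (NO inverse
identity), contact families `C j α`, second-order contacts `X₂ j α`, compensators `Wc j α`, the jet laws (St)(Wt)(Sr-conj)(Wr-conj-c) of the
UNDRESSED jets `Js⁰`, and `hcomp : ½·tadpole G_j (Wc j α μ y ν y′) + conjDefect G_j (𝕄 j) (…) = 0`, `G_j := coDressKSymAt ctr Lc (KInvStep Lc j)`. -/
theorem axisReflectionCovariant_dressSymCtr (hLc : Odd Lc) (Js : ℕ → JetData 3 Lc)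
    (M : ℕ → MKer 4 (Fib 3)) (hM : ∀ j, Spr (M j))
    (hSt : ∀ (j : ℕ) (κ' : Fin 4) (u t : Fin 4 → ℤ), (Js j).S κ' (u + (Lc : ℤ) • t) = ExpKernelCalculus.shiftK (-((Lc : ℤ) • t)) ((Js j).S κ' u))
    (hWt : ∀ (j : ℕ) (μ : Fin 4) (y : Fin 4 → ℤ) (ν : Fin 4) (y' t : Fin 4 → ℤ),
      (Js j).W μ (y + t) ν (y' + t) = ExpKernelCalculus.shiftK (-((Lc : ℤ) • t)) ((Js j).W μ y ν y'))
    (C : ℕ → Fin 4 → Fin 4 → (Fin 4 → ℤ) → MKer 4 (Fib 3)) (Cc δc : ℕ → ℝ) (hC : ∀ j α, LocStencil (C j α) (Cc j) (δc j))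
    (hδc : ∀ j, 0 < δc j) (X₂ Wc : ℕ → Fin 4 → Fin 4 → (Fin 4 → ℤ) → Fin 4 → (Fin 4 → ℤ) → MKer 4 (Fib 3))
    (hX₂ : ∀ j α μ y ν y', Loc (X₂ j α μ y ν y')) (hWc : ∀ j α μ y ν y', Loc (Wc j α μ y ν y'))
    (hSrC : ∀ (j : ℕ) (α κ' : Fin 4) (u : Fin 4 → ℤ),
      (Js j).S κ' (bref α κ' u) = reflSign α κ' • refK (Φ Lc α) ((Js j).S κ' u + conjV (M j) (C j α κ' u)))
    (hWrC : ∀ (j : ℕ) (α μ : Fin 4) (y : Fin 4 → ℤ) (ν : Fin 4) (y' : Fin 4 → ℤ),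
      (Js j).W μ (bref α μ y) ν (bref α ν y') = (reflSign α μ * reflSign α ν) • refK (Φ Lc α) ((Js j).W μ y ν y' +
        conjW (M j) (vertexOfK (coDressKSymAt (toSite (ctrOff 4 Lc)) Lc (KInvStep (d := 3) Lc j)) Lc (Js j).S μ y)
          (vertexOfK (coDressKSymAt (toSite (ctrOff 4 Lc)) Lc (KInvStep (d := 3) Lc j)) Lc (Js j).S ν y')
          (vertexOfK (coDressKSymAt (toSite (ctrOff 4 Lc)) Lc (KInvStep (d := 3) Lc j)) Lc (C j α) μ y)
          (vertexOfK (coDressKSymAt (toSite (ctrOff 4 Lc)) Lc (KInvStep (d := 3) Lc j)) Lc (C j α) ν y') (X₂ j α μ y ν y')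
          + Wc j α μ y ν y'))
    (hcomp : ∀ (j : ℕ) (α μ : Fin 4) (y : Fin 4 → ℤ) (ν : Fin 4) (y' : Fin 4 → ℤ),
      (1 / 2 : ℝ) * tadpole (coDressKSymAt (toSite (ctrOff 4 Lc)) Lc (KInvStep (d := 3) Lc j)) (Wc j α μ y ν y')
        + conjDefect (coDressKSymAt (toSite (ctrOff 4 Lc)) Lc (KInvStep (d := 3) Lc j)) (M j)
            (vertexOfK (coDressKSymAt (toSite (ctrOff 4 Lc)) Lc (KInvStep (d := 3) Lc j)) Lc (Js j).S μ y)
            (vertexOfK (coDressKSymAt (toSite (ctrOff 4 Lc)) Lc (KInvStep (d := 3) Lc j)) Lc (Js j).S ν y')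
            (vertexOfK (coDressKSymAt (toSite (ctrOff 4 Lc)) Lc (KInvStep (d := 3) Lc j)) Lc (C j α) μ y)
            (vertexOfK (coDressKSymAt (toSite (ctrOff 4 Lc)) Lc (KInvStep (d := 3) Lc j)) Lc (C j α) ν y') (X₂ j α μ y ν y') = 0) :
    ∀ j : ℕ, AxisReflectionCovariant
      (flipK (TbalOf Lc (fun j => dressSymAt (ctrOff_mem_box (d := 4) (one_le_of_neZero Lc)) (Js j)) j)) :=
  axisReflectionCovariant_flipK_TbalOf_dressSymCtr_compensated hLc Js M hM hSt hWt C Cc δc hC hδc X₂ Wc hX₂ hWc hSrC hWrC hcomp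

/-! ## §2 The row's END at JetData level: `D1Drift` for the centred symmetrised-dressed family -/

/-- **ROW D1, SYMMETRISED LITERAL, JetData-LEVEL END.**  For `Odd Lc`, `2 ≤ Lc`, UNDRESSED step jets `Js⁰ : ℕ → JetData 3 Lc` and the
centred symmetrised-dressed family `j ↦ dressSymAt ctr (Js⁰ j)`:
`D1Drift Lc (j ↦ dressSymAt ctr (Js⁰ j)) Nc μ ν` ⟸ EXACTLY {`hW` (Ward transversality of the family — a direct BINDER), the compensated hR∧hSX
sockets of §1 (`𝕄 j`, `C j α`, `X₂ j α`, `Wc j α`, (St)(Wt)(Sr-conj)(Wr-conj-c), `hcomp`), `D1Tel Lc (j ↦ …) Jc`, `D1Rep Lc Jc Nc μ ν a SL k`,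
B5 `h12`∕`h126`, window `(cc, M)`, `μ ≠ ν`, `Nc ≠ 0`} — `OneStepKernelFamily.d1Drift_of_D1Tel_D1Rep` with `hR` from §1.
The colour parameter `Nc : ℝ` of `D1Drift` is left free.  HONEST: no binder is proved here; 0∕4 binders of the row. -/
theorem d1Drift_dressSymCtr_of_hW_compensated_D1Tel_D1Rep (hLc : Odd Lc) (hL2 : 2 ≤ Lc) (Js : ℕ → JetData 3 Lc)
    -- hW: a direct binder
    (hW : ∀ j, WardTransversal (flipK (TbalOf Lc (fun j => dressSymAt (ctrOff_mem_box (d := 4) (one_le_of_neZero Lc)) (Js j)) j)))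
    -- hR ∧ hSX: the compensated sockets
    (M : ℕ → MKer 4 (Fib 3)) (hM : ∀ j, Spr (M j))
    (hSt : ∀ (j : ℕ) (κ' : Fin 4) (u t : Fin 4 → ℤ), (Js j).S κ' (u + (Lc : ℤ) • t) = ExpKernelCalculus.shiftK (-((Lc : ℤ) • t)) ((Js j).S κ' u))
    (hWt : ∀ (j : ℕ) (μ : Fin 4) (y : Fin 4 → ℤ) (ν : Fin 4) (y' t : Fin 4 → ℤ),
      (Js j).W μ (y + t) ν (y' + t) = ExpKernelCalculus.shiftK (-((Lc : ℤ) • t)) ((Js j).W μ y ν y'))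
    (C : ℕ → Fin 4 → Fin 4 → (Fin 4 → ℤ) → MKer 4 (Fib 3)) (Cc δc : ℕ → ℝ) (hC : ∀ j α, LocStencil (C j α) (Cc j) (δc j))
    (hδc : ∀ j, 0 < δc j) (X₂ Wc : ℕ → Fin 4 → Fin 4 → (Fin 4 → ℤ) → Fin 4 → (Fin 4 → ℤ) → MKer 4 (Fib 3))
    (hX₂ : ∀ j α μ y ν y', Loc (X₂ j α μ y ν y')) (hWc : ∀ j α μ y ν y', Loc (Wc j α μ y ν y'))
    (hSrC : ∀ (j : ℕ) (α κ' : Fin 4) (u : Fin 4 → ℤ),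
      (Js j).S κ' (bref α κ' u) = reflSign α κ' • refK (Φ Lc α) ((Js j).S κ' u + conjV (M j) (C j α κ' u)))
    (hWrC : ∀ (j : ℕ) (α μ : Fin 4) (y : Fin 4 → ℤ) (ν : Fin 4) (y' : Fin 4 → ℤ),
      (Js j).W μ (bref α μ y) ν (bref α ν y') = (reflSign α μ * reflSign α ν) • refK (Φ Lc α) ((Js j).W μ y ν y' +
        conjW (M j) (vertexOfK (coDressKSymAt (toSite (ctrOff 4 Lc)) Lc (KInvStep (d := 3) Lc j)) Lc (Js j).S μ y)
          (vertexOfK (coDressKSymAt (toSite (ctrOff 4 Lc)) Lc (KInvStep (d := 3) Lc j)) Lc (Js j).S ν y')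
          (vertexOfK (coDressKSymAt (toSite (ctrOff 4 Lc)) Lc (KInvStep (d := 3) Lc j)) Lc (C j α) μ y)
          (vertexOfK (coDressKSymAt (toSite (ctrOff 4 Lc)) Lc (KInvStep (d := 3) Lc j)) Lc (C j α) ν y') (X₂ j α μ y ν y')
          + Wc j α μ y ν y'))
    (hcomp : ∀ (j : ℕ) (α μ : Fin 4) (y : Fin 4 → ℤ) (ν : Fin 4) (y' : Fin 4 → ℤ),
      (1 / 2 : ℝ) * tadpole (coDressKSymAt (toSite (ctrOff 4 Lc)) Lc (KInvStep (d := 3) Lc j)) (Wc j α μ y ν y')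
        + conjDefect (coDressKSymAt (toSite (ctrOff 4 Lc)) Lc (KInvStep (d := 3) Lc j)) (M j)
            (vertexOfK (coDressKSymAt (toSite (ctrOff 4 Lc)) Lc (KInvStep (d := 3) Lc j)) Lc (Js j).S μ y)
            (vertexOfK (coDressKSymAt (toSite (ctrOff 4 Lc)) Lc (KInvStep (d := 3) Lc j)) Lc (Js j).S ν y')
            (vertexOfK (coDressKSymAt (toSite (ctrOff 4 Lc)) Lc (KInvStep (d := 3) Lc j)) Lc (C j α) μ y)
            (vertexOfK (coDressKSymAt (toSite (ctrOff 4 Lc)) Lc (KInvStep (d := 3) Lc j)) Lc (C j α) ν y') (X₂ j α μ y ν y') = 0)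
    -- the route theorem's own binders (printed B5 facts, channel, colour parameter, window), verbatim
    (a : ℝ) (ha : 0 < a)
    (h12 : B5.Prop12Printed (fam (fun i : ℕ+ × ℕ => ((i.1 : ℕ+) : ℕ)) (fun i => i.1.pos) MvE a ha))
    (h126 : B5.Kernel126_127Printed (kfam (fun i : ℕ+ × ℕ => ((i.1 : ℕ+) : ℕ)) MvE))
    {L : Type*} {SL : Finset L} (hSL : SL.Nonempty) (k : L → Fin 4) {μ ν : Fin 4} (hμν : μ ≠ ν) {Nc : ℝ} (hNc : Nc ≠ 0)
    (Jc : ∀ m : ℕ, JetData 3 (Lc ^ m))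
    (htel : D1Tel Lc (fun j => dressSymAt (ctrOff_mem_box (d := 4) (one_le_of_neZero Lc)) (Js j)) Jc)
    {cc : ℝ} {Mw : ℕ → ℕ} (hc : 1 ≤ cc) (hMw : ∀ L : ℕ, 2 ≤ L → 1 ≤ Mw L ∧ (L : ℝ) ≤ cc * Mw L) (hML : ∀ L : ℕ, 2 ≤ L → Mw L ≤ L)
    (hrep : D1Rep Lc Jc Nc μ ν a SL k) :
    D1Drift Lc (fun j => dressSymAt (ctrOff_mem_box (d := 4) (one_le_of_neZero Lc)) (Js j)) Nc μ ν :=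
  d1Drift_of_D1Tel_D1Rep a ha h12 h126 hSL k hμν hNc hL2 _ Jc hW
    (axisReflectionCovariant_dressSymCtr hLc Js M hM hSt hWt C Cc δc hC hδc X₂ Wc hX₂ hWc hSrC hWrC hcomp) htel hc hMw hML hrep


/-! ## §3 (v1.1) The END with `hW` DERIVED from the Ward-letter sockets of `KernelWardSymEnd` -/

open B6BondElimination (unitVec) in
open KernelWard (divV divW) in
open OneStepKernelFamily (colH) in
open Summit.QuantumFields.BalabanUV.Beta.ChartConjugationRelative (RelInv) in
open Summit.QuantumFields.BalabanUV.Beta.KernelWardRelative (gaugeWt) in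
open Summit.QuantumFields.BalabanUV.Beta.KernelWardSymEnd (wardTransversal_flipK_TbalOf_dressSymCtr_rel) in
/-- **ROW D1, SYMMETRISED LITERAL, JetData-LEVEL END WITH `hW` FROM WARD LETTERS (v1.1).**  §2's
`d1Drift_dressSymCtr_of_hW_compensated_D1Tel_D1Rep` with the direct binder `hW` REPLACED by the sym hW END
`KernelWardSymEnd.wardTransversal_flipK_TbalOf_dressSymCtr_rel`: `D1Drift Lc (j ↦ dressSymAt ctr (Js⁰ j)) Nc μ ν` ⟸ EXACTLY {the Ward-letter
sockets over a relative inverse (coarse projector `E`, `RelInv G_j (𝕄 j) E`, column-difference law `hH`∕`cH`, S-letter `hSd` via `X j y` (Loc,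
E-commuting), W-letter `hWd` via `Xw₂ j y ν y′` (Loc, E-commuting) with tadpole-null remainder `Nr`), the compensated hR∧hSX sockets of §1 (same
spread `𝕄 j`), `D1Tel`, `D1Rep`, B5 `h12`∕`h126`, window, `μ ≠ ν`, `Nc ≠ 0`, `2 ≤ Lc`, `Odd Lc`}.  HONEST: no socket is proved here; root-level
binders hW-sockets ∕ hR-sockets ∕ hSX-socket ∕ D1Tel ∕ D1Rep — 0 discharged. -/
theorem d1Drift_dressSymCtr_of_wardLetters_compensated_D1Tel_D1Rep (hLc : Odd Lc) (hL2 : 2 ≤ Lc) (Js : ℕ → JetData 3 Lc)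
    -- the shared spread of the relative inverse
    (M : ℕ → MKer 4 (Fib 3)) (hM : ∀ j, Spr (M j))
    -- hW: the Ward-letter sockets of `KernelWardSymEnd.wardTransversal_flipK_TbalOf_dressSymCtr_rel`
    (E : MKer 4 (Fib 3)) (hE : Spr E) (hRI : ∀ j, RelInv (coDressKSymAt (toSite (ctrOff 4 Lc)) Lc (KInvStep (d := 3) Lc j)) (M j) E)
    (hSt : ∀ (j : ℕ) (κ' : Fin 4) (u t : Fin 4 → ℤ), (Js j).S κ' (u + (Lc : ℤ) • t) = ExpKernelCalculus.shiftK (-((Lc : ℤ) • t)) ((Js j).S κ' u))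
    (hWt : ∀ (j : ℕ) (μ : Fin 4) (y : Fin 4 → ℤ) (ν : Fin 4) (y' t : Fin 4 → ℤ),
      (Js j).W μ (y + t) ν (y' + t) = ExpKernelCalculus.shiftK (-((Lc : ℤ) • t)) ((Js j).W μ y ν y'))
    (cH : ℕ → ℝ) (hH : ∀ (j : ℕ) (y : Fin 4 → ℤ) (κ' : Fin 4) (u : Fin 4 → ℤ),
      ∑ μ, (colH (coDressKSymAt (toSite (ctrOff 4 Lc)) Lc (KInvStep (d := 3) Lc j)) Lc μ (y - unitVec μ) κ' u
        - colH (coDressKSymAt (toSite (ctrOff 4 Lc)) Lc (KInvStep (d := 3) Lc j)) Lc μ y κ' u) = cH j * gaugeWt Lc y κ' u)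
    (X : ℕ → (Fin 4 → ℤ) → MKer 4 (Fib 3)) (hX : ∀ j y, Loc (X j y)) (hEX : ∀ j y, comp E (X j y) = comp (X j y) E)
    (Xw₂ Nr : ℕ → (Fin 4 → ℤ) → Fin 4 → (Fin 4 → ℤ) → MKer 4 (Fib 3)) (hXw₂ : ∀ j y ν y', Loc (Xw₂ j y ν y'))
    (hNr : ∀ j y ν y', Loc (Nr j y ν y')) (hEXw₂ : ∀ j y ν y', comp E (Xw₂ j y ν y') = comp (Xw₂ j y ν y') E)
    (hSd : ∀ (j : ℕ) (y : Fin 4 → ℤ), cH j • ∑ v ∈ box 4 Lc, divV (Js j).S ((Lc : ℤ) • y + toSite v) = conjV (M j) (X j y))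
    (hWd : ∀ (j : ℕ) (y : Fin 4 → ℤ) (ν : Fin 4) (y' : Fin 4 → ℤ),
      divW (Js j).W y ν y' = conjW (M j) 0 (vertexOfK (coDressKSymAt (toSite (ctrOff 4 Lc)) Lc (KInvStep (d := 3) Lc j)) Lc (Js j).S ν y')
        (X j y) 0 (Xw₂ j y ν y') + Nr j y ν y')
    (hN0 : ∀ j y ν y', tadpole (coDressKSymAt (toSite (ctrOff 4 Lc)) Lc (KInvStep (d := 3) Lc j)) (Nr j y ν y') = 0)
    -- hR ∧ hSX: the compensated sockets of §1
    (C : ℕ → Fin 4 → Fin 4 → (Fin 4 → ℤ) → MKer 4 (Fib 3)) (Cc δc : ℕ → ℝ) (hC : ∀ j α, LocStencil (C j α) (Cc j) (δc j))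
    (hδc : ∀ j, 0 < δc j) (X₂ Wc : ℕ → Fin 4 → Fin 4 → (Fin 4 → ℤ) → Fin 4 → (Fin 4 → ℤ) → MKer 4 (Fib 3))
    (hX₂ : ∀ j α μ y ν y', Loc (X₂ j α μ y ν y')) (hWc : ∀ j α μ y ν y', Loc (Wc j α μ y ν y'))
    (hSrC : ∀ (j : ℕ) (α κ' : Fin 4) (u : Fin 4 → ℤ),
      (Js j).S κ' (bref α κ' u) = reflSign α κ' • refK (Φ Lc α) ((Js j).S κ' u + conjV (M j) (C j α κ' u)))
    (hWrC : ∀ (j : ℕ) (α μ : Fin 4) (y : Fin 4 → ℤ) (ν : Fin 4) (y' : Fin 4 → ℤ),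
      (Js j).W μ (bref α μ y) ν (bref α ν y') = (reflSign α μ * reflSign α ν) • refK (Φ Lc α) ((Js j).W μ y ν y' +
        conjW (M j) (vertexOfK (coDressKSymAt (toSite (ctrOff 4 Lc)) Lc (KInvStep (d := 3) Lc j)) Lc (Js j).S μ y)
          (vertexOfK (coDressKSymAt (toSite (ctrOff 4 Lc)) Lc (KInvStep (d := 3) Lc j)) Lc (Js j).S ν y')
          (vertexOfK (coDressKSymAt (toSite (ctrOff 4 Lc)) Lc (KInvStep (d := 3) Lc j)) Lc (C j α) μ y)
          (vertexOfK (coDressKSymAt (toSite (ctrOff 4 Lc)) Lc (KInvStep (d := 3) Lc j)) Lc (C j α) ν y') (X₂ j α μ y ν y')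
          + Wc j α μ y ν y'))
    (hcomp : ∀ (j : ℕ) (α μ : Fin 4) (y : Fin 4 → ℤ) (ν : Fin 4) (y' : Fin 4 → ℤ),
      (1 / 2 : ℝ) * tadpole (coDressKSymAt (toSite (ctrOff 4 Lc)) Lc (KInvStep (d := 3) Lc j)) (Wc j α μ y ν y')
        + conjDefect (coDressKSymAt (toSite (ctrOff 4 Lc)) Lc (KInvStep (d := 3) Lc j)) (M j)
            (vertexOfK (coDressKSymAt (toSite (ctrOff 4 Lc)) Lc (KInvStep (d := 3) Lc j)) Lc (Js j).S μ y)
            (vertexOfK (coDressKSymAt (toSite (ctrOff 4 Lc)) Lc (KInvStep (d := 3) Lc j)) Lc (Js j).S ν y')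
            (vertexOfK (coDressKSymAt (toSite (ctrOff 4 Lc)) Lc (KInvStep (d := 3) Lc j)) Lc (C j α) μ y)
            (vertexOfK (coDressKSymAt (toSite (ctrOff 4 Lc)) Lc (KInvStep (d := 3) Lc j)) Lc (C j α) ν y') (X₂ j α μ y ν y') = 0)
    -- the route theorem's own binders, verbatim
    (a : ℝ) (ha : 0 < a)
    (h12 : B5.Prop12Printed (fam (fun i : ℕ+ × ℕ => ((i.1 : ℕ+) : ℕ)) (fun i => i.1.pos) MvE a ha))
    (h126 : B5.Kernel126_127Printed (kfam (fun i : ℕ+ × ℕ => ((i.1 : ℕ+) : ℕ)) MvE))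
    {L : Type*} {SL : Finset L} (hSL : SL.Nonempty) (k : L → Fin 4) {μ ν : Fin 4} (hμν : μ ≠ ν) {Nc : ℝ} (hNc : Nc ≠ 0)
    (Jc : ∀ m : ℕ, JetData 3 (Lc ^ m))
    (htel : D1Tel Lc (fun j => dressSymAt (ctrOff_mem_box (d := 4) (one_le_of_neZero Lc)) (Js j)) Jc)
    {cc : ℝ} {Mw : ℕ → ℕ} (hc : 1 ≤ cc) (hMw : ∀ L : ℕ, 2 ≤ L → 1 ≤ Mw L ∧ (L : ℝ) ≤ cc * Mw L) (hML : ∀ L : ℕ, 2 ≤ L → Mw L ≤ L)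
    (hrep : D1Rep Lc Jc Nc μ ν a SL k) :
    D1Drift Lc (fun j => dressSymAt (ctrOff_mem_box (d := 4) (one_le_of_neZero Lc)) (Js j)) Nc μ ν :=
  d1Drift_dressSymCtr_of_hW_compensated_D1Tel_D1Rep hLc hL2 Js
    (wardTransversal_flipK_TbalOf_dressSymCtr_rel Js M E hM hE hRI hSt hWt cH hH X hX hEX Xw₂ Nr hXw₂ hNr hEXw₂ hSd hWd hN0)
    M hM hSt hWt C Cc δc hC hδc X₂ Wc hX₂ hWc hSrC hWrC hcomp a ha h12 h126 hSL k hμν hNc Jc htel hc hMw hML hrep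


/-! ## §4 (v1.2) The row-D1 owner's variant: hW from the PARITY-form Ward sockets with a separate Ward-side spread -/

open B6BondElimination (unitVec) in
open KernelWard (divV divW) in
open OneStepKernelFamily (colH) in
open Summit.QuantumFields.BalabanUV.Beta.ChartConjugationRelative (RelInv) in
open Summit.QuantumFields.BalabanUV.Beta.BorderedHessian (sgnK) in
open Summit.QuantumFields.BalabanUV.Beta.KernelWardRelative (gaugeWt) in
open Summit.QuantumFields.BalabanUV.Beta.KernelWardSymEnd (wardTransversal_flipK_TbalOf_dressSymCtr_rel_parity) in
/-- **ROW D1, SYMMETRISED LITERAL, JetData-LEVEL END — hW FROM THE WARD SOCKETS** (v1.1).  §2 with the direct binder `hW` replaced by the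
sockets of `KernelWardSymEnd.wardTransversal_flipK_TbalOf_dressSymCtr_rel_parity` (beta-d1-formalise-leaf-04): a spread `E` and Ward-side spread
kernels `𝕄ʷ j` with `RelInv G_j (𝕄ʷ j) E`, the ℋ-column Ward law `hH` with constants `cH j`, localised Ward generators `Xʷ j y` COMMUTING with `E`,
second-order Ward data `X₂ʷ j y ν y′` commuting with `E`, a localised PARITY-ODD remainder `Nr` (`trK Nr = −sgnK Nr`), and the divergence laws
`hSd` ∕ `hWd` of the undressed jets; then the hR∧hSX sockets of §1 (conjugated reflection laws against `𝕄 j`, compensators, `hcomp`), `D1Tel`, `D1Rep`,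
the printed B5 facts and the window.  `G_j := coDressKSymAt ctr Lc (KInvStep Lc j)`.  HONEST: every socket is a displayed hypothesis; none is proved
here; 0 binders of the row discharged. -/
theorem d1Drift_dressSymCtr_of_wardSockets_compensated_D1Tel_D1Rep (hLc : Odd Lc) (hL2 : 2 ≤ Lc) (Js : ℕ → JetData 3 Lc)
    -- hW: the Ward sockets (parity form)
    (Mw : ℕ → MKer 4 (Fib 3)) (E : MKer 4 (Fib 3)) (hMw' : ∀ j, Spr (Mw j)) (hE : Spr E)
    (hRw : ∀ j, RelInv (coDressKSymAt (toSite (ctrOff 4 Lc)) Lc (KInvStep (d := 3) Lc j)) (Mw j) E)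
    (hSt : ∀ (j : ℕ) (κ' : Fin 4) (u t : Fin 4 → ℤ), (Js j).S κ' (u + (Lc : ℤ) • t) = ExpKernelCalculus.shiftK (-((Lc : ℤ) • t)) ((Js j).S κ' u))
    (hWt : ∀ (j : ℕ) (μ : Fin 4) (y : Fin 4 → ℤ) (ν : Fin 4) (y' t : Fin 4 → ℤ),
      (Js j).W μ (y + t) ν (y' + t) = ExpKernelCalculus.shiftK (-((Lc : ℤ) • t)) ((Js j).W μ y ν y'))
    (cH : ℕ → ℝ) (hH : ∀ (j : ℕ) (y : Fin 4 → ℤ) (κ' : Fin 4) (u : Fin 4 → ℤ),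
      ∑ μ, (colH (coDressKSymAt (toSite (ctrOff 4 Lc)) Lc (KInvStep (d := 3) Lc j)) Lc μ (y - unitVec μ) κ' u
        - colH (coDressKSymAt (toSite (ctrOff 4 Lc)) Lc (KInvStep (d := 3) Lc j)) Lc μ y κ' u) = cH j * gaugeWt Lc y κ' u)
    (Xw : ℕ → (Fin 4 → ℤ) → MKer 4 (Fib 3)) (hXw : ∀ j y, Loc (Xw j y)) (hEXw : ∀ j y, comp E (Xw j y) = comp (Xw j y) E)
    (X₂w Nr : ℕ → (Fin 4 → ℤ) → Fin 4 → (Fin 4 → ℤ) → MKer 4 (Fib 3)) (hX₂w : ∀ j y ν y', Loc (X₂w j y ν y'))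
    (hNr : ∀ j y ν y', Loc (Nr j y ν y')) (hEX₂w : ∀ j y ν y', comp E (X₂w j y ν y') = comp (X₂w j y ν y') E)
    (hSd : ∀ (j : ℕ) (y : Fin 4 → ℤ), cH j • ∑ v ∈ box 4 Lc, divV (Js j).S ((Lc : ℤ) • y + toSite v) = conjV (Mw j) (Xw j y))
    (hWd : ∀ (j : ℕ) (y : Fin 4 → ℤ) (ν : Fin 4) (y' : Fin 4 → ℤ),
      divW (Js j).W y ν y' = conjW (Mw j) 0 (vertexOfK (coDressKSymAt (toSite (ctrOff 4 Lc)) Lc (KInvStep (d := 3) Lc j)) Lc (Js j).S ν y')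
        (Xw j y) 0 (X₂w j y ν y') + Nr j y ν y')
    (hNt : ∀ j y ν y', trK (Nr j y ν y') = -sgnK (Nr j y ν y'))
    -- hR ∧ hSX: the compensated sockets
    (M : ℕ → MKer 4 (Fib 3)) (hM : ∀ j, Spr (M j))
    (C : ℕ → Fin 4 → Fin 4 → (Fin 4 → ℤ) → MKer 4 (Fib 3)) (Cc δc : ℕ → ℝ) (hC : ∀ j α, LocStencil (C j α) (Cc j) (δc j))
    (hδc : ∀ j, 0 < δc j) (X₂ Wc : ℕ → Fin 4 → Fin 4 → (Fin 4 → ℤ) → Fin 4 → (Fin 4 → ℤ) → MKer 4 (Fib 3))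
    (hX₂ : ∀ j α μ y ν y', Loc (X₂ j α μ y ν y')) (hWc : ∀ j α μ y ν y', Loc (Wc j α μ y ν y'))
    (hSrC : ∀ (j : ℕ) (α κ' : Fin 4) (u : Fin 4 → ℤ),
      (Js j).S κ' (bref α κ' u) = reflSign α κ' • refK (Φ Lc α) ((Js j).S κ' u + conjV (M j) (C j α κ' u)))
    (hWrC : ∀ (j : ℕ) (α μ : Fin 4) (y : Fin 4 → ℤ) (ν : Fin 4) (y' : Fin 4 → ℤ),
      (Js j).W μ (bref α μ y) ν (bref α ν y') = (reflSign α μ * reflSign α ν) • refK (Φ Lc α) ((Js j).W μ y ν y' +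
        conjW (M j) (vertexOfK (coDressKSymAt (toSite (ctrOff 4 Lc)) Lc (KInvStep (d := 3) Lc j)) Lc (Js j).S μ y)
          (vertexOfK (coDressKSymAt (toSite (ctrOff 4 Lc)) Lc (KInvStep (d := 3) Lc j)) Lc (Js j).S ν y')
          (vertexOfK (coDressKSymAt (toSite (ctrOff 4 Lc)) Lc (KInvStep (d := 3) Lc j)) Lc (C j α) μ y)
          (vertexOfK (coDressKSymAt (toSite (ctrOff 4 Lc)) Lc (KInvStep (d := 3) Lc j)) Lc (C j α) ν y') (X₂ j α μ y ν y')
          + Wc j α μ y ν y'))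
    (hcomp : ∀ (j : ℕ) (α μ : Fin 4) (y : Fin 4 → ℤ) (ν : Fin 4) (y' : Fin 4 → ℤ),
      (1 / 2 : ℝ) * tadpole (coDressKSymAt (toSite (ctrOff 4 Lc)) Lc (KInvStep (d := 3) Lc j)) (Wc j α μ y ν y')
        + conjDefect (coDressKSymAt (toSite (ctrOff 4 Lc)) Lc (KInvStep (d := 3) Lc j)) (M j)
            (vertexOfK (coDressKSymAt (toSite (ctrOff 4 Lc)) Lc (KInvStep (d := 3) Lc j)) Lc (Js j).S μ y)
            (vertexOfK (coDressKSymAt (toSite (ctrOff 4 Lc)) Lc (KInvStep (d := 3) Lc j)) Lc (Js j).S ν y')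
            (vertexOfK (coDressKSymAt (toSite (ctrOff 4 Lc)) Lc (KInvStep (d := 3) Lc j)) Lc (C j α) μ y)
            (vertexOfK (coDressKSymAt (toSite (ctrOff 4 Lc)) Lc (KInvStep (d := 3) Lc j)) Lc (C j α) ν y') (X₂ j α μ y ν y') = 0)
    -- the route theorem's own binders, verbatim
    (a : ℝ) (ha : 0 < a)
    (h12 : B5.Prop12Printed (fam (fun i : ℕ+ × ℕ => ((i.1 : ℕ+) : ℕ)) (fun i => i.1.pos) MvE a ha))
    (h126 : B5.Kernel126_127Printed (kfam (fun i : ℕ+ × ℕ => ((i.1 : ℕ+) : ℕ)) MvE))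
    {L : Type*} {SL : Finset L} (hSL : SL.Nonempty) (k : L → Fin 4) {μ ν : Fin 4} (hμν : μ ≠ ν) {Nc : ℝ} (hNc : Nc ≠ 0)
    (Jc : ∀ m : ℕ, JetData 3 (Lc ^ m))
    (htel : D1Tel Lc (fun j => dressSymAt (ctrOff_mem_box (d := 4) (one_le_of_neZero Lc)) (Js j)) Jc)
    {cc : ℝ} {Mw' : ℕ → ℕ} (hc : 1 ≤ cc) (hMwin : ∀ L : ℕ, 2 ≤ L → 1 ≤ Mw' L ∧ (L : ℝ) ≤ cc * Mw' L) (hML : ∀ L : ℕ, 2 ≤ L → Mw' L ≤ L)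
    (hrep : D1Rep Lc Jc Nc μ ν a SL k) :
    D1Drift Lc (fun j => dressSymAt (ctrOff_mem_box (d := 4) (one_le_of_neZero Lc)) (Js j)) Nc μ ν :=
  d1Drift_dressSymCtr_of_hW_compensated_D1Tel_D1Rep hLc hL2 Js
    (wardTransversal_flipK_TbalOf_dressSymCtr_rel_parity Js Mw E hMw' hE hRw hSt hWt cH hH Xw hXw hEXw X₂w Nr hX₂w hNr hEX₂w hSd hWd hNt)
    M hM hSt hWt C Cc δc hC hδc X₂ Wc hX₂ hWc hSrC hWrC hcomp a ha h12 h126 hSL k hμν hNc Jc htel hc hMwin hML hrep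

/-! ## §5 (v1.3) The spreads of record instantiated: `𝕄ʷ = 𝕄 := bhKStep 3 Lc`, `E := symEc Lc`; `Spr`∕`RelInv` sockets discharged by name -/

open B6BondElimination (unitVec) in
open KernelWard (divV divW) in
open OneStepKernelFamily (colH) in
open Summit.QuantumFields.BalabanUV.Beta.BorderedHessian (sgnK bhKStep spr_bhKStep) in
open Summit.QuantumFields.BalabanUV.Beta.KernelWardRelative (gaugeWt) in
open Summit.QuantumFields.BalabanUV.Beta.SymSliceProjectorKernel (symEc) in
open Summit.QuantumFields.BalabanUV.Beta.SymSliceProjectorSpread (spr_symEc) in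
open Summit.QuantumFields.BalabanUV.Beta.RelInvSymBorderedHessianStep (relInv_coDressKSymAt_KInvStep_bhKStep) in
/-- **ROW D1, SYMMETRISED LITERAL, JetData-LEVEL END AT THE SPREADS OF RECORD** (v1.3).  §4
`d1Drift_dressSymCtr_of_wardSockets_compensated_D1Tel_D1Rep` with `𝕄ʷ j = 𝕄 j := bhKStep 3 Lc j`, `E := symEc Lc`, and the sockets
`Spr (bhKStep 3 Lc j)`, `Spr (symEc Lc)`, `RelInv (coDressKSymAt ctr Lc (KInvStep Lc j)) (bhKStep 3 Lc j) (symEc Lc)` (every `j`) DISCHARGED by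
`spr_bhKStep`, `spr_symEc`, `relInv_coDressKSymAt_KInvStep_bhKStep`.  What remains displayed: the jet letters (St)(Wt), the ℋ-column Ward law
`hH` of `G_j := coDressKSymAt ctr Lc (KInvStep Lc j)`, the Ward divergence laws (Sd)(Wd) of the undressed jets against `bhKStep` with localised
data commuting with `symEc Lc` and a parity-odd remainder, the conjugated reflection laws (Sr-conj)(Wr-conj-c) against `bhKStep` with contacts and
compensators, `hcomp`, then `D1Tel`, `D1Rep`, the printed B5 facts and the window.  HONEST: bookkeeping; 0∕5 root-level classes discharged. -/
theorem d1Drift_dressSymCtr_of_letters_bhKStep_symEc_D1Tel_D1Rep (hLc : Odd Lc) (hL2 : 2 ≤ Lc) (Js : ℕ → JetData 3 Lc)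
    -- hW: the Ward letters against `bhKStep 3 Lc j` ∕ `symEc Lc`
    (hSt : ∀ (j : ℕ) (κ' : Fin 4) (u t : Fin 4 → ℤ), (Js j).S κ' (u + (Lc : ℤ) • t) = ExpKernelCalculus.shiftK (-((Lc : ℤ) • t)) ((Js j).S κ' u))
    (hWt : ∀ (j : ℕ) (μ : Fin 4) (y : Fin 4 → ℤ) (ν : Fin 4) (y' t : Fin 4 → ℤ),
      (Js j).W μ (y + t) ν (y' + t) = ExpKernelCalculus.shiftK (-((Lc : ℤ) • t)) ((Js j).W μ y ν y'))
    (cH : ℕ → ℝ) (hH : ∀ (j : ℕ) (y : Fin 4 → ℤ) (κ' : Fin 4) (u : Fin 4 → ℤ),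
      ∑ μ, (colH (coDressKSymAt (toSite (ctrOff 4 Lc)) Lc (KInvStep (d := 3) Lc j)) Lc μ (y - unitVec μ) κ' u
        - colH (coDressKSymAt (toSite (ctrOff 4 Lc)) Lc (KInvStep (d := 3) Lc j)) Lc μ y κ' u) = cH j * gaugeWt Lc y κ' u)
    (Xw : ℕ → (Fin 4 → ℤ) → MKer 4 (Fib 3)) (hXw : ∀ j y, Loc (Xw j y)) (hEXw : ∀ j y, comp (symEc Lc) (Xw j y) = comp (Xw j y) (symEc Lc))
    (X₂w Nr : ℕ → (Fin 4 → ℤ) → Fin 4 → (Fin 4 → ℤ) → MKer 4 (Fib 3)) (hX₂w : ∀ j y ν y', Loc (X₂w j y ν y'))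
    (hNr : ∀ j y ν y', Loc (Nr j y ν y')) (hEX₂w : ∀ j y ν y', comp (symEc Lc) (X₂w j y ν y') = comp (X₂w j y ν y') (symEc Lc))
    (hSd : ∀ (j : ℕ) (y : Fin 4 → ℤ), cH j • ∑ v ∈ box 4 Lc, divV (Js j).S ((Lc : ℤ) • y + toSite v) = conjV (bhKStep 3 Lc j) (Xw j y))
    (hWd : ∀ (j : ℕ) (y : Fin 4 → ℤ) (ν : Fin 4) (y' : Fin 4 → ℤ),
      divW (Js j).W y ν y' = conjW (bhKStep 3 Lc j) 0 (vertexOfK (coDressKSymAt (toSite (ctrOff 4 Lc)) Lc (KInvStep (d := 3) Lc j)) Lc (Js j).S ν y')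
        (Xw j y) 0 (X₂w j y ν y') + Nr j y ν y')
    (hNt : ∀ j y ν y', trK (Nr j y ν y') = -sgnK (Nr j y ν y'))
    -- hR ∧ hSX: the compensated letters against `bhKStep 3 Lc j`
    (C : ℕ → Fin 4 → Fin 4 → (Fin 4 → ℤ) → MKer 4 (Fib 3)) (Cc δc : ℕ → ℝ) (hC : ∀ j α, LocStencil (C j α) (Cc j) (δc j))
    (hδc : ∀ j, 0 < δc j) (X₂ Wc : ℕ → Fin 4 → Fin 4 → (Fin 4 → ℤ) → Fin 4 → (Fin 4 → ℤ) → MKer 4 (Fib 3))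
    (hX₂ : ∀ j α μ y ν y', Loc (X₂ j α μ y ν y')) (hWc : ∀ j α μ y ν y', Loc (Wc j α μ y ν y'))
    (hSrC : ∀ (j : ℕ) (α κ' : Fin 4) (u : Fin 4 → ℤ),
      (Js j).S κ' (bref α κ' u) = reflSign α κ' • refK (Φ Lc α) ((Js j).S κ' u + conjV (bhKStep 3 Lc j) (C j α κ' u)))
    (hWrC : ∀ (j : ℕ) (α μ : Fin 4) (y : Fin 4 → ℤ) (ν : Fin 4) (y' : Fin 4 → ℤ),
      (Js j).W μ (bref α μ y) ν (bref α ν y') = (reflSign α μ * reflSign α ν) • refK (Φ Lc α) ((Js j).W μ y ν y' +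
        conjW (bhKStep 3 Lc j) (vertexOfK (coDressKSymAt (toSite (ctrOff 4 Lc)) Lc (KInvStep (d := 3) Lc j)) Lc (Js j).S μ y)
          (vertexOfK (coDressKSymAt (toSite (ctrOff 4 Lc)) Lc (KInvStep (d := 3) Lc j)) Lc (Js j).S ν y')
          (vertexOfK (coDressKSymAt (toSite (ctrOff 4 Lc)) Lc (KInvStep (d := 3) Lc j)) Lc (C j α) μ y)
          (vertexOfK (coDressKSymAt (toSite (ctrOff 4 Lc)) Lc (KInvStep (d := 3) Lc j)) Lc (C j α) ν y') (X₂ j α μ y ν y')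
          + Wc j α μ y ν y'))
    (hcomp : ∀ (j : ℕ) (α μ : Fin 4) (y : Fin 4 → ℤ) (ν : Fin 4) (y' : Fin 4 → ℤ),
      (1 / 2 : ℝ) * tadpole (coDressKSymAt (toSite (ctrOff 4 Lc)) Lc (KInvStep (d := 3) Lc j)) (Wc j α μ y ν y')
        + conjDefect (coDressKSymAt (toSite (ctrOff 4 Lc)) Lc (KInvStep (d := 3) Lc j)) (bhKStep 3 Lc j)
            (vertexOfK (coDressKSymAt (toSite (ctrOff 4 Lc)) Lc (KInvStep (d := 3) Lc j)) Lc (Js j).S μ y)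
            (vertexOfK (coDressKSymAt (toSite (ctrOff 4 Lc)) Lc (KInvStep (d := 3) Lc j)) Lc (Js j).S ν y')
            (vertexOfK (coDressKSymAt (toSite (ctrOff 4 Lc)) Lc (KInvStep (d := 3) Lc j)) Lc (C j α) μ y)
            (vertexOfK (coDressKSymAt (toSite (ctrOff 4 Lc)) Lc (KInvStep (d := 3) Lc j)) Lc (C j α) ν y') (X₂ j α μ y ν y') = 0)
    -- the route theorem's own binders, verbatim
    (a : ℝ) (ha : 0 < a)
    (h12 : B5.Prop12Printed (fam (fun i : ℕ+ × ℕ => ((i.1 : ℕ+) : ℕ)) (fun i => i.1.pos) MvE a ha))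
    (h126 : B5.Kernel126_127Printed (kfam (fun i : ℕ+ × ℕ => ((i.1 : ℕ+) : ℕ)) MvE))
    {L : Type*} {SL : Finset L} (hSL : SL.Nonempty) (k : L → Fin 4) {μ ν : Fin 4} (hμν : μ ≠ ν) {Nc : ℝ} (hNc : Nc ≠ 0)
    (Jc : ∀ m : ℕ, JetData 3 (Lc ^ m))
    (htel : D1Tel Lc (fun j => dressSymAt (ctrOff_mem_box (d := 4) (one_le_of_neZero Lc)) (Js j)) Jc)
    {cc : ℝ} {Mw' : ℕ → ℕ} (hc : 1 ≤ cc) (hMwin : ∀ L : ℕ, 2 ≤ L → 1 ≤ Mw' L ∧ (L : ℝ) ≤ cc * Mw' L) (hML : ∀ L : ℕ, 2 ≤ L → Mw' L ≤ L)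
    (hrep : D1Rep Lc Jc Nc μ ν a SL k) :
    D1Drift Lc (fun j => dressSymAt (ctrOff_mem_box (d := 4) (one_le_of_neZero Lc)) (Js j)) Nc μ ν :=
  d1Drift_dressSymCtr_of_wardSockets_compensated_D1Tel_D1Rep hLc hL2 Js
    (fun j => bhKStep 3 Lc j) (symEc Lc) (fun j => spr_bhKStep (d := 3) (Lc := Lc) j) (spr_symEc (one_le_of_neZero Lc))
    (fun j => relInv_coDressKSymAt_KInvStep_bhKStep (d := 3) (Lc := Lc) j)
    hSt hWt cH hH Xw hXw hEXw X₂w Nr hX₂w hNr hEX₂w hSd hWd hNt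
    (fun j => bhKStep 3 Lc j) (fun j => spr_bhKStep (d := 3) (Lc := Lc) j)
    C Cc δc hC hδc X₂ Wc hX₂ hWc hSrC hWrC hcomp a ha h12 h126 hSL k hμν hNc Jc htel hc hMwin hML hrep

end

end Summit.QuantumFields.BalabanUV.Beta.RowD1JointEndSym
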